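import Mathlib.Analysis.Calculus.Deriv.MeanValue
import Mathlib.Topology.Order.IntermediateValue
import HarnessLib

/-!
# Phase hand-over at a stage switch (layer T, R1-DESIGN §6 G3 "E_down switch", G6 (iv))

HONEST FRAMING (cell `pub-fluidc`, blueprint seat bp3, gen 17): low prior, high value-of-information
experiment on Tao's machine paradigm; NOT a claim that NS blows up. Pure one-variable real analysis.

WHY. At a stage switch the phase coordinate changes (`τ = b1` in S1, `c1` in S2, …). The perturbed
trajectory `y`, synchronised with the reference in the OLD phase at parameter `σ`, must be
re-synchronised in the NEW phase `p`: find `σ'` near `σ` with `y_p(σ') = c` (`c := x̂_p(t_sw)`), and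
enclose the jump of the deviation `y(σ') − y(σ)`. With DERIVATIVE RANGES `ẏᵢ ∈ [mᵢ, Mᵢ]` on
`[σ − Δ, σ + Δ]` (tabulated by the kernel from `F(x̂) ± |J|W`), `0 < m_p`, and `|y_p(σ) − c| < m_p Δ`,
this file proves: `σ'` EXISTS in `[σ − Δ, σ + Δ]` (intermediate value theorem) and for every `i`
`yᵢ(σ') − yᵢ(σ) = −(y_p(σ) − c) · θ · dᵢ` for some `θ ∈ [1/M_p, 1/m_p]`, `dᵢ ∈ [mᵢ, Mᵢ]` (mean value
theorem, twice) — an enclosure that is second-order accurate when the ranges are tight, so the kernel's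
interval arithmetic recovers the projection `P'e` along the flow plus a second-order remainder
(probe flag `--sw2nd`). No second derivatives are needed.

[cite: Tao2016AveragedNS, §5.5 Thm 5.3 (5.5)]
-/

noncomputable section

open Set

namespace Summit.NavierStokesRegularity.FluidComputer

namespace Handover

/-- Growth from a derivative range on an interval (mean value theorem): for `u < v` in the
interval, `f v − f u = f'(ξ)(v − u)` with `ξ` strictly between. [folklore] -/
theorem exists_slope {f d : ℝ → ℝ} {lo hi u v : ℝ} (huv : u < v) (hu : lo ≤ u) (hv : v ≤ hi)
    (hf : ∀ ξ ∈ Icc lo hi, HasDerivAt f (d ξ) ξ) :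
    ∃ ξ ∈ Ioo u v, f v - f u = d ξ * (v - u) := by
  have hfc : ContinuousOn f (Icc u v) := fun ξ hξ =>
    (hf ξ ⟨hu.trans hξ.1, hξ.2.trans hv⟩).continuousAt.continuousWithinAt
  have hff' : ∀ ξ ∈ Ioo u v, HasDerivAt f (d ξ) ξ := fun ξ hξ =>
    hf ξ ⟨hu.trans hξ.1.le, hξ.2.le.trans hv⟩
  obtain ⟨ξ, hξ, hslope⟩ := exists_hasDerivAt_eq_slope f d huv hfc hff'
  refine ⟨ξ, hξ, ?_⟩
  have hne : v - u ≠ 0 := sub_ne_zero.2 huv.ne'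
  rw [hslope, div_mul_cancel₀ _ hne]

/-- **Phase hand-over.** See the module docstring. [folklore] -/
theorem handover {ι : Type*} {y d : ℝ → ι → ℝ} {m M : ι → ℝ} {σ Δ c : ℝ} (p : ι)
    (hΔ : 0 < Δ)
    (hy : ∀ i, ∀ ξ ∈ Icc (σ - Δ) (σ + Δ), HasDerivAt (fun r => y r i) (d ξ i) ξ)
    (hm : ∀ i, ∀ ξ ∈ Icc (σ - Δ) (σ + Δ), m i ≤ d ξ i ∧ d ξ i ≤ M i)
    (hmp : 0 < m p) (hc : |y σ p - c| < m p * Δ) :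
    ∃ σ' ∈ Icc (σ - Δ) (σ + Δ), y σ' p = c ∧
      ∀ i, ∃ θ ∈ Icc (M p)⁻¹ (m p)⁻¹, ∃ dd ∈ Icc (m i) (M i),
        y σ' i - y σ i = -(y σ p - c) * θ * dd := by
  have hσm : σ - Δ ≤ σ := by linarith
  have hσp : σ ≤ σ + Δ := by linarith
  have hcabs := abs_lt.1 hc
  -- the phase coordinate passes `c` on `[σ − Δ, σ + Δ]`
  have hup : c ≤ y (σ + Δ) p := by
    obtain ⟨ξ, hξ, h⟩ := exists_slope (f := fun r => y r p) (d := fun ξ => d ξ p)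
      (lt_add_of_pos_right σ hΔ) hσm le_rfl (hy p)
    have hξm := (hm p ξ ⟨by linarith [hξ.1], hξ.2.le⟩).1
    have : y (σ + Δ) p - y σ p = d ξ p * Δ := by rw [h]; ring
    nlinarith
  have hdn : y (σ - Δ) p ≤ c := by
    obtain ⟨ξ, hξ, h⟩ := exists_slope (f := fun r => y r p) (d := fun ξ => d ξ p)
      (sub_lt_self σ hΔ) le_rfl hσp (hy p)
    have hξm := (hm p ξ ⟨hξ.1.le, by linarith [hξ.2]⟩).1
    have : y σ p - y (σ - Δ) p = d ξ p * Δ := by rw [h]; ring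
    nlinarith
  have hcont : ContinuousOn (fun r => y r p) (Icc (σ - Δ) (σ + Δ)) := fun ξ hξ =>
    (hy p ξ hξ).continuousAt.continuousWithinAt
  obtain ⟨σ', hσ', hyσ''⟩ := intermediate_value_Icc (hσm.trans hσp) hcont ⟨hdn, hup⟩
  have hyσ' : y σ' p = c := hyσ''
  refine ⟨σ', hσ', hyσ', fun i => ?_⟩
  have hMp : m p ≤ M p := by
    have := hm p σ ⟨hσm, hσp⟩; exact this.1.trans this.2
  have hMp0 : 0 < M p := hmp.trans_le hMp
  rcases lt_trichotomy σ σ' with hlt | heq | hgt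
  · -- σ < σ'
    obtain ⟨ζ, hζ, hζs⟩ := exists_slope (f := fun r => y r p) (d := fun ξ => d ξ p) hlt hσm hσ'.2 (hy p)
    obtain ⟨ξ, hξ, hξs⟩ := exists_slope (f := fun r => y r i) (d := fun ξ => d ξ i) hlt hσm hσ'.2 (hy i)
    have hζI : ζ ∈ Icc (σ - Δ) (σ + Δ) := ⟨by linarith [hζ.1], hζ.2.le.trans hσ'.2⟩
    have hξI : ξ ∈ Icc (σ - Δ) (σ + Δ) := ⟨by linarith [hξ.1], hξ.2.le.trans hσ'.2⟩
    have hdζ := hm p ζ hζI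
    have hdζ0 : 0 < d ζ p := hmp.trans_le hdζ.1
    refine ⟨(d ζ p)⁻¹, ⟨?_, ?_⟩, d ξ i, hm i ξ hξI, ?_⟩
    · exact inv_anti₀ hdζ0 hdζ.2
    · exact inv_anti₀ hmp hdζ.1
    · have h1 : y σ' p - y σ p = d ζ p * (σ' - σ) := hζs
      rw [hyσ'] at h1
      have h2 : σ' - σ = -(y σ p - c) * (d ζ p)⁻¹ := by
        field_simp; linarith
      have h3 : y σ' i - y σ i = d ξ i * (σ' - σ) := hξs
      rw [h3, h2]; ring
  · -- σ = σ'
    subst heq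
    refine ⟨(m p)⁻¹, ⟨inv_anti₀ hmp hMp, le_rfl⟩, d σ i, hm i σ ⟨hσm, hσp⟩, ?_⟩
    rw [hyσ']; ring
  · -- σ' < σ
    obtain ⟨ζ, hζ, hζs⟩ := exists_slope (f := fun r => y r p) (d := fun ξ => d ξ p) hgt hσ'.1 hσp (hy p)
    obtain ⟨ξ, hξ, hξs⟩ := exists_slope (f := fun r => y r i) (d := fun ξ => d ξ i) hgt hσ'.1 hσp (hy i)
    have hζI : ζ ∈ Icc (σ - Δ) (σ + Δ) := ⟨hσ'.1.trans hζ.1.le, by linarith [hζ.2]⟩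
    have hξI : ξ ∈ Icc (σ - Δ) (σ + Δ) := ⟨hσ'.1.trans hξ.1.le, by linarith [hξ.2]⟩
    have hdζ := hm p ζ hζI
    have hdζ0 : 0 < d ζ p := hmp.trans_le hdζ.1
    refine ⟨(d ζ p)⁻¹, ⟨?_, ?_⟩, d ξ i, hm i ξ hξI, ?_⟩
    · exact inv_anti₀ hdζ0 hdζ.2
    · exact inv_anti₀ hmp hdζ.1
    · have h1 : y σ p - y σ' p = d ζ p * (σ - σ') := hζs
      rw [hyσ'] at h1
      have h2 : σ' - σ = -(y σ p - c) * (d ζ p)⁻¹ := by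
        field_simp; linarith
      have h3 : y σ i - y σ' i = d ξ i * (σ - σ') := hξs
      have h4 : y σ' i - y σ i = d ξ i * (σ' - σ) := by linarith
      rw [h4, h2]; ring

end Handover

end Summit.NavierStokesRegularity.FluidComputer
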